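import Summits.QuantumFields.BalabanUV.T4Continuum.Spine.NE4.BlockCovarianceRate
import Literature.MathematicalPhysics.QuantumFieldTheory.Balaban1983to89.B5Prop11Leaves
import Literature.MathematicalPhysics.QuantumFieldTheory.Balaban1983to89.B5G183RateObstruction

/-!
# Spine/NE4/BalabanPhiAxisRate — (R60) AN EXACT η-DEPENDENCE OF A PRINTED BAŁABAN SYMBOL: the function `φ_μ(p′) = 1 + a·Σ_l |u(p′+l)|²|v_μ(p′+l)|²∕Δ(p′+l)` of
# [Balaban1984PropagatorsI] (1.84) p. 31 (tree: `B5Prop11Leaves.phiMu`), for a TRANSVERSE component `μ` at a momentum `p′ = q·e_ι` ALONG A LATTICE AXIS, equals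
# `1 + a·((2 + cos q)∕(12 sin²(q∕2)) + L^{−2k}∕6)` at averaging depth `n = L^k` — its dependence on the depth is EXACTLY `a·L^{−2k}∕6` (rate `θ = L⁻²`, by (R59))

Cell `pub-balaban-gaps` (YM blitz G2), seat `ne4`, generation 16 (unit `pub-balaban-gaps-ne4-g16`); record `HOME/ne/NE4.md` §5 (R60).

HONEST FRAMING.  NE4 = `T4CouplingMatching.ScaleShiftRate` is NOT IN PRINT ([Balaban1987RG1] = CMP **109** (1987) p. 264) and NOT proved; rows NE2∕NE3 (η-DIFFERENCE bounds for
Bałaban's propagators) are located, NOT proved.  This file proves ONE exact η-dependence statement about ONE printed object of [Balaban1984PropagatorsI] (B5) — the function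
`φ_μ(p′)` of (1.84) p. 31 AS TRANSCRIBED IN THE TREE (`Literature/…/B5Prop11Leaves.phiMu n a μ s = 1 + a·Σ_{k : Fin d → Fin n} Ur n k s · uFactorr n (k μ) (s μ) ∕ DeltaXir n 0
(shiftr n k s)`, with the tree's real forms `Ur` = `|u(p′+l)|²`, `uFactorr` = `|v_μ(p′+l)|²`, `DeltaXir` = `Δ(p′+l)` of `B4Strip`) — in the SPECIAL CASE of a momentum along a
lattice axis and a transverse component, where the `d`-dimensional alias sum collapses to the one-dimensional fibre of (R59) (`BlockCovarianceRate`).  It is a statement about a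
lattice SYMBOL (trigonometric sums), not about Bałaban's propagators `G_k` themselves, not about (0.4)'s full averaging with its gauge structure beyond what (1.84) prints, and
not about NE4; no status word moves (NE4 stays DEPENDENT; NE2∕NE3 stay located; spine 0∕9).  One finite T⁴; NOT ℝ⁴, NOT infinite volume, NOT a mass gap, NOT Clay.

CONTENT.
* §1 ON THE AXIS THE ALIAS SUM COLLAPSES: at `s = q·e_ι` (`axisMom`), every alias `k : Fin d → Fin n` with a nonzero transverse entry contributes `0` (`Ur_axis_eq_zero`: a factor
  `|v_ν|² = S₁(0)∕S_ξ(2πk_ν) = 0`), and on the axis aliases `k = j·e_ι` (`axisAlias`) the printed summand is `S₁(q)∕S_ξ(q + 2πj)²` for a transverse `μ ≠ ι`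
  (`summand_axisAlias`; `S₁(x) = 4 sin²(x∕2)`, `S_ξ(x) = 4n² sin²(x∕2n)` — the tree's `S1r_eq`, `Sxir_eq`).
* §2 **`aliasSum_axis_eq_blockCov`**: `Σ_{k} Ur·uFactorr∕DeltaXir (q·e_ι) = BlockCovariance.blockCov (n−1) (q∕(2πn))` — the printed alias sum IS (R59)'s on-axis block covariance
  (term by term: `S₁(q)∕S_ξ(q+2πj)² = |u_j|²∕D_j`, `term_eq_blockCov_term`).
* §3 **`phiMu_axis_eq`**: for `1 ≤ n`, `sin(q∕2) ≠ 0`, `μ ≠ ι`: `phiMu n a μ (q·e_ι) = 1 + a·((2 + cos q)∕(12 sin²(q∕2)) + 1∕(6n²))` ((R59)'s `blockCov_eq`); at depth `n = L^k`: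
  **`phiMu_axis_scale_eq`** `= 1 + a·((2 + cos q)∕(12 sin²(q∕2)) + (L⁻²)^k∕6)` and **`phiMu_axis_step`**: `φ^{(k+1)} − φ^{(k)} = −a·((1 − L⁻²)∕6)·(L⁻²)^k` EXACTLY,
  independent of `q` — an η-DIFFERENCE statement for a printed symbol with rate `θ = L⁻²` and constant `a(1 − L⁻²)∕6`.

WHAT THIS SAYS FOR THE ROW (census (R60); classification words UNCHANGED): the first kernel statement in this row about the η-dependence of an object PRINTED in Bałaban's papers
(not a caricature): the (1.84) symbol forgets the averaging depth at rate `L⁻²` EXACTLY, on the axis, for transverse components.  A special case only — general `p′`, the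
longitudinal component (a SIXTH Fejér moment), the propagators `G_k` and the operators of rows NE2∕NE3 are untouched; nothing of Bałaban's THEOREMS is asserted.
v2 (same generation, APPEND): §4 THE PRINTED TWO-SIDED BOUND (1.85) ON THE AXIS WITH SHARP CONSTANTS — `Δ₀(p′)·φ_μ(p′) = 4 sin²(q∕2) + a·((2 + cos q)∕3 + 2 sin²(q∕2)∕(3n²))`
EXACTLY (`Delta0_mul_phiMu_axis_eq`), hence `a∕3 ≤ Δ₀φ_μ ≤ 4 + 5a∕3` uniformly in the depth `n` (`Delta0_mul_phiMu_axis_bounds`; the tree's general `ineq185_lower` ∕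
`ineq185_upper'` give `a(4∕π²)^{d+2} ≤ Δ₀φ_μ ≤ 4d + a + a·d`): in this printed corner the η-UNIFORM statement (the kind [B5] prints) and the η-DIFFERENCE statement (§3, the kind
rows NE2∕NE3 need) sit side by side, both exact.
-/

noncomputable section

namespace Summit.QuantumFields.BalabanUV.T4Continuum.Spine.NE4

open Real Finset
open Literature.MathematicalPhysics.QuantumFieldTheory.Balaban1983to89.B4Strip (S1r Sxir S1r_eq Sxir_eq uFactorr Ur DeltaXir shiftr)
open Literature.MathematicalPhysics.QuantumFieldTheory.Balaban1983to89.B5Prop11Leaves (phiMu)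
open Literature.MathematicalPhysics.QuantumFieldTheory.Balaban1983to89.B5G183RateObstruction (Sxir_zero)
open BlockCovariance (tfib formFactorSq fibreSym blockCov formFactorSq_mul_sin_sq blockCov_eq)

namespace BalabanPhiAxis

variable {d : ℕ}

/-! ## §1 On the axis the alias sum collapses to the one-dimensional fibre -/

section Axis

/-- A MOMENTUM ALONG THE LATTICE AXIS `ι`: `p′ = q·e_ι`. [folklore] -/
def axisMom (ι : Fin d) (q : ℝ) : Fin d → ℝ := fun ν => if ν = ι then q else 0

/-- AN ALIAS ALONG THE AXIS `ι`: `l = 2πj·e_ι`, i.e. `k = j·e_ι`. [folklore] -/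
def axisAlias {n : ℕ} [NeZero n] (ι : Fin d) (j : Fin n) : Fin d → Fin n := fun ν => if ν = ι then j else 0

/-- [bookkeeping] `axisAlias ι` is injective. [folklore] -/
theorem axisAlias_injective {n : ℕ} [NeZero n] (ι : Fin d) : Function.Injective (axisAlias (n := n) ι) := by
  intro j j' h
  have := congrFun h ι
  simpa [axisAlias] using this

/-- [bookkeeping] `S₁(0) = 0` (`S_ξ(0) = 0` is the tree's `B5G183RateObstruction.Sxir_zero`, reused by import). [folklore] -/
theorem S1r_zero : S1r 0 = 0 := by simp [S1r]

/-- [bookkeeping] The printed factor `|v_μ|²` at a zero momentum component: `uFactorr n 0 0 = 1` (the continuous extension) and `uFactorr n j 0 = 0` for an alias `j ≠ 0`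
(`S₁(0) = 0`). [folklore] -/
theorem uFactorr_at_zero (n j : ℕ) : uFactorr n j 0 = if j = 0 then 1 else 0 := by
  unfold uFactorr
  split_ifs <;> simp_all [S1r_zero]

/-- [bookkeeping] For `q ≠ 0` both branches of the tree's `uFactorr` give `S₁(q)∕S_ξ(q + 2πj)`. [folklore] -/
theorem uFactorr_of_ne_zero (n : ℕ) {q : ℝ} (hq : q ≠ 0) (j : ℕ) : uFactorr n j q = S1r q / Sxir n (q + 2 * π * j) := by
  unfold uFactorr
  split_ifs with hj
  · subst hj; simp
  · rfl

/-- **OFF-AXIS ALIASES CONTRIBUTE NOTHING**: if `k ν ≠ 0` for some `ν ≠ ι`, then `|u(p′ + l)|² = 0` at `p′ = q·e_ι` (the factor `|v_ν|² = S₁(0)∕S_ξ(2πk_ν) = 0`). [folklore] -/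
theorem Ur_axis_eq_zero {n : ℕ} (ι : Fin d) (q : ℝ) {k : Fin d → Fin n} {ν : Fin d} (hν : ν ≠ ι) (hk : (k ν : ℕ) ≠ 0) :
    Ur n k (axisMom ι q) = 0 := by
  unfold Ur
  apply Finset.prod_eq_zero (Finset.mem_univ ν)
  rw [axisMom, if_neg hν, uFactorr_at_zero, if_neg hk]

/-- [bookkeeping] An alias with all transverse entries zero IS an axis alias. [folklore] -/
theorem eq_axisAlias_of_transverse_zero {n : ℕ} [NeZero n] (ι : Fin d) {k : Fin d → Fin n} (hk : ∀ ν, ν ≠ ι → k ν = 0) :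
    k = axisAlias ι (k ι) := by
  funext ν
  by_cases h : ν = ι
  · subst h; simp [axisAlias]
  · rw [axisAlias, if_neg h, hk ν h]

/-- **THE PRINTED SUMMAND ON AN AXIS ALIAS** (transverse component `μ ≠ ι`, `q ≠ 0`): `|u|²·|v_μ|²∕Δ` at `p′ = q·e_ι`, `l = 2πj·e_ι` equals `S₁(q)∕S_ξ(q + 2πj)²`
(`|u|² = S₁(q)∕S_ξ(q+2πj)` from the axis direction, all other factors `1`; `|v_μ|² = 1`; `Δ = S_ξ(q + 2πj)`). [folklore] -/
theorem summand_axisAlias {n : ℕ} [NeZero n] {ι μ : Fin d} (hμ : μ ≠ ι) {q : ℝ} (hq : q ≠ 0) (j : Fin n) :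
    Ur n (axisAlias ι j) (axisMom ι q) * uFactorr n (axisAlias ι j μ : ℕ) (axisMom ι q μ) / DeltaXir n 0 (shiftr n (axisAlias ι j) (axisMom ι q)) =
      S1r q / Sxir n (q + 2 * π * (j : ℕ)) ^ 2 := by
  have hU : Ur n (axisAlias ι j) (axisMom ι q) = S1r q / Sxir n (q + 2 * π * (j : ℕ)) := by
    unfold Ur
    rw [Finset.prod_eq_single ι (fun ν _ hν => by rw [axisMom, if_neg hν, axisAlias, if_neg hν, uFactorr_at_zero]; simp)
      (fun h => absurd (Finset.mem_univ ι) h)]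
    rw [axisMom, if_pos rfl, axisAlias, if_pos rfl, uFactorr_of_ne_zero n hq]
  have hV : uFactorr n (axisAlias ι j μ : ℕ) (axisMom ι q μ) = 1 := by
    rw [axisMom, if_neg hμ, axisAlias, if_neg hμ, uFactorr_at_zero]; simp
  have hD : DeltaXir n 0 (shiftr n (axisAlias ι j) (axisMom ι q)) = Sxir n (q + 2 * π * (j : ℕ)) := by
    unfold DeltaXir
    rw [add_zero, Finset.sum_eq_single ι (fun ν _ hν => by rw [shiftr, axisMom, if_neg hν, axisAlias, if_neg hν]; simp [Sxir_zero])
      (fun h => absurd (Finset.mem_univ ι) h)]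
    rw [shiftr, axisMom, if_pos rfl, axisAlias, if_pos rfl]
  rw [hU, hV, hD, mul_one, div_div, sq]

end Axis

/-! ## §2 The printed alias sum on the axis IS (R59)'s block covariance -/

section Bridge

/-- **TERM BY TERM**: `S₁(q)∕S_ξ(q + 2πj)² = |u_j|²∕D_j` — the printed axis summand is (R59)'s `formFactorSq∕fibreSym` at block size `K = n`, `x₀ = q∕(2πn)` (`1 ≤ n`, `sin(q∕2) ≠ 0`,
`j < n`). [folklore] -/
theorem term_eq_blockCov_term {n : ℕ} (hn : 1 ≤ n) {q : ℝ} (hq : Real.sin (q / 2) ≠ 0) (j : ℕ) :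
    S1r q / Sxir n (q + 2 * π * j) ^ 2 = formFactorSq (n - 1) (q / (2 * π * n)) j / fibreSym (n - 1) (q / (2 * π * n)) j := by
  have hK : (((n - 1 : ℕ) : ℝ) + 1) = (n : ℝ) := by rw [Nat.cast_sub hn]; push_cast; ring
  have hn0 : (n : ℝ) ≠ 0 := by exact_mod_cast (by omega : n ≠ 0)
  have ht : π * tfib (n - 1) (q / (2 * π * n)) j = (q + 2 * π * j) / (2 * n) := by
    rw [tfib, hK]; field_simp
  have hSx : Sxir n (q + 2 * π * j) = 4 * (n : ℝ) ^ 2 * Real.sin (π * tfib (n - 1) (q / (2 * π * n)) j) ^ 2 := by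
    rw [Sxir_eq, ht, show (q + 2 * π * j) / (2 * (n : ℝ)) = (q + 2 * π * j) / (2 * n) from rfl]
  have hfib : fibreSym (n - 1) (q / (2 * π * n)) j = Sxir n (q + 2 * π * j) := by
    rw [fibreSym, hK, hSx]
  have hmul := formFactorSq_mul_sin_sq (n - 1) (q / (2 * π * n)) j
  rw [hK, show π * (n : ℝ) * (q / (2 * π * n)) = q / 2 by field_simp] at hmul
  -- `formFactorSq · (Sxir/4) = sin²(q/2) = S1r q / 4`
  have hS1 : S1r q = 4 * Real.sin (q / 2) ^ 2 := S1r_eq q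
  have hSx0 : Sxir n (q + 2 * π * j) ≠ 0 := by
    intro h0
    rw [hSx] at h0
    have : (n : ℝ) ^ 2 * Real.sin (π * tfib (n - 1) (q / (2 * π * n)) j) ^ 2 = 0 := by linarith
    rw [this, mul_zero] at hmul
    exact hq (pow_eq_zero_iff (n := 2) (by norm_num) |>.1 hmul.symm)
  have hff : formFactorSq (n - 1) (q / (2 * π * n)) j = S1r q / Sxir n (q + 2 * π * j) := by
    rw [eq_div_iff hSx0, hSx, hS1, ← hmul]; ring
  rw [hfib, hff, div_div, sq]

/-- **THE PRINTED ALIAS SUM ON THE AXIS IS (R59)'s BLOCK COVARIANCE**: for a transverse component `μ ≠ ι`, `1 ≤ n`, `sin(q∕2) ≠ 0`,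
`Σ_{k : Fin d → Fin n} |u(p′+l)|²|v_μ(p′+l)|²∕Δ(p′+l)` at `p′ = q·e_ι` equals `blockCov (n − 1) (q∕(2πn))`. [folklore] -/
theorem aliasSum_axis_eq_blockCov {n : ℕ} [NeZero n] (hn : 1 ≤ n) {ι μ : Fin d} (hμ : μ ≠ ι) {q : ℝ} (hq : Real.sin (q / 2) ≠ 0) :
    ∑ k : Fin d → Fin n, Ur n k (axisMom ι q) * uFactorr n (k μ : ℕ) (axisMom ι q μ) / DeltaXir n 0 (shiftr n k (axisMom ι q)) =
      blockCov (n - 1) (q / (2 * π * n)) := by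
  have hq0 : q ≠ 0 := by intro h; rw [h, zero_div, Real.sin_zero] at hq; exact hq rfl
  set F : (Fin d → Fin n) → ℝ := fun k => Ur n k (axisMom ι q) * uFactorr n (k μ : ℕ) (axisMom ι q μ) / DeltaXir n 0 (shiftr n k (axisMom ι q)) with hF
  -- restrict to the axis aliases
  have hvanish : ∀ k ∈ (Finset.univ : Finset (Fin d → Fin n)), k ∉ Finset.univ.image (axisAlias ι) → F k = 0 := by
    intro k _ hk
    have : ∃ ν, ν ≠ ι ∧ k ν ≠ 0 := by
      by_contra hno
      push Not at hno
      exact hk (Finset.mem_image.2 ⟨k ι, Finset.mem_univ _, (eq_axisAlias_of_transverse_zero ι fun ν hν => by simpa using hno ν hν).symm⟩)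
    obtain ⟨ν, hν, hkν⟩ := this
    have hkν' : (k ν : ℕ) ≠ 0 := fun h => hkν (Fin.ext h)
    simp only [hF, Ur_axis_eq_zero ι q hν hkν', zero_mul, zero_div]
  rw [← Finset.sum_subset (Finset.subset_univ (Finset.univ.image (axisAlias (n := n) ι))) hvanish,
    Finset.sum_image fun j _ j' _ h => axisAlias_injective ι h]
  simp only [hF]
  rw [Finset.sum_congr rfl fun j _ => summand_axisAlias hμ hq0 j]
  -- reindex `Fin n` as `range n` and match (R59)'s sum
  rw [blockCov, Nat.sub_add_cancel hn, ← Fin.sum_univ_eq_sum_range (fun j => formFactorSq (n - 1) (q / (2 * π * n)) j / fibreSym (n - 1) (q / (2 * π * n)) j) n]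
  exact Finset.sum_congr rfl fun j _ => term_eq_blockCov_term hn hq j

end Bridge

/-! ## §3 The printed `φ_μ(p′)` on the axis: closed form and EXACT depth dependence -/

section Phi

/-- **THE PRINTED (1.84) ON THE AXIS, CLOSED FORM**: for `1 ≤ n`, a transverse component `μ ≠ ι` and `sin(q∕2) ≠ 0`,
`φ_μ(q·e_ι) = 1 + a·((2 + cos q)∕(12 sin²(q∕2)) + 1∕(6n²))` — the tree's `B5Prop11Leaves.phiMu` ([Balaban1984PropagatorsI] (1.84) p. 31) evaluated EXACTLY, via §2 and (R59)'s
`blockCov_eq`. [cite: Balaban1984PropagatorsI, (1.84) p.31] -/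
theorem phiMu_axis_eq {n : ℕ} [NeZero n] (hn : 1 ≤ n) (a : ℝ) {ι μ : Fin d} (hμ : μ ≠ ι) {q : ℝ} (hq : Real.sin (q / 2) ≠ 0) :
    phiMu n a μ (axisMom ι q) = 1 + a * ((2 + Real.cos q) / (12 * Real.sin (q / 2) ^ 2) + 1 / (6 * (n : ℝ) ^ 2)) := by
  have hK : (((n - 1 : ℕ) : ℝ) + 1) = (n : ℝ) := by rw [Nat.cast_sub hn]; push_cast; ring
  have hn0 : (n : ℝ) ≠ 0 := by exact_mod_cast (by omega : n ≠ 0)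
  have harg : π * (((n - 1 : ℕ) : ℝ) + 1) * (q / (2 * π * n)) = q / 2 := by rw [hK]; field_simp
  have harg2 : 2 * π * (((n - 1 : ℕ) : ℝ) + 1) * (q / (2 * π * n)) = q := by rw [hK]; field_simp
  have hx : Real.sin (π * (((n - 1 : ℕ) : ℝ) + 1) * (q / (2 * π * n))) ≠ 0 := by rwa [harg]
  rw [phiMu, aliasSum_axis_eq_blockCov hn hμ hq, blockCov_eq _ hx, harg, harg2, hK]

/-- **AT AVERAGING DEPTH `n = L^k`**: `φ_μ(q·e_ι) = 1 + a·((2 + cos q)∕(12 sin²(q∕2)) + (L⁻²)^k∕6)` (`1 ≤ L`, `μ ≠ ι`, `sin(q∕2) ≠ 0`).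
[cite: Balaban1984PropagatorsI, (1.84) p.31] -/
theorem phiMu_axis_scale_eq {L : ℕ} [NeZero L] (hL : 1 ≤ L) (k : ℕ) (a : ℝ) {ι μ : Fin d} (hμ : μ ≠ ι) {q : ℝ} (hq : Real.sin (q / 2) ≠ 0) :
    phiMu (L ^ k) a μ (axisMom ι q) = 1 + a * ((2 + Real.cos q) / (12 * Real.sin (q / 2) ^ 2) + ((L : ℝ)⁻¹ ^ 2) ^ k / 6) := by
  rw [phiMu_axis_eq (Nat.one_le_pow k L hL) a hμ hq]
  have hpow : ((L : ℝ)⁻¹ ^ 2) ^ k = (((L : ℝ) ^ k) ^ 2)⁻¹ := by rw [← pow_mul, ← pow_mul, mul_comm 2 k, inv_pow]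
  rw [hpow]
  push_cast
  ring

/-- **THE EXACT η-DIFFERENCE OF A PRINTED SYMBOL**: `φ_μ^{(k+1)}(q·e_ι) − φ_μ^{(k)}(q·e_ι) = −a·((1 − L⁻²)∕6)·(L⁻²)^k` — the (1.84) symbol forgets the averaging depth at the
GEOMETRIC rate `θ = L⁻²`, with constant `a(1 − L⁻²)∕6`, independently of the axis momentum `q` (`1 ≤ L`, `μ ≠ ι`, `sin(q∕2) ≠ 0`). [folklore] -/
theorem phiMu_axis_step {L : ℕ} [NeZero L] (hL : 1 ≤ L) (k : ℕ) (a : ℝ) {ι μ : Fin d} (hμ : μ ≠ ι) {q : ℝ} (hq : Real.sin (q / 2) ≠ 0) :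
    phiMu (L ^ (k + 1)) a μ (axisMom ι q) - phiMu (L ^ k) a μ (axisMom ι q) = -a * ((1 - (L : ℝ)⁻¹ ^ 2) / 6) * ((L : ℝ)⁻¹ ^ 2) ^ k := by
  rw [phiMu_axis_scale_eq hL (k + 1) a hμ hq, phiMu_axis_scale_eq hL k a hμ hq, pow_succ]
  ring

/-- [bookkeeping] In absolute value: `|φ^{(k+1)} − φ^{(k)}| = |a|·((1 − L⁻²)∕6)·(L⁻²)^k`. [folklore] -/
theorem abs_phiMu_axis_step {L : ℕ} [NeZero L] (hL : 1 ≤ L) (k : ℕ) (a : ℝ) {ι μ : Fin d} (hμ : μ ≠ ι) {q : ℝ} (hq : Real.sin (q / 2) ≠ 0) :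
    |phiMu (L ^ (k + 1)) a μ (axisMom ι q) - phiMu (L ^ k) a μ (axisMom ι q)| = |a| * ((1 - (L : ℝ)⁻¹ ^ 2) / 6) * ((L : ℝ)⁻¹ ^ 2) ^ k := by
  have hL1 : (1 : ℝ) ≤ L := by exact_mod_cast hL
  have hinv : (L : ℝ)⁻¹ ^ 2 ≤ 1 := by
    have h0 : 0 ≤ (L : ℝ)⁻¹ := inv_nonneg.2 (by linarith)
    have h1 : (L : ℝ)⁻¹ ≤ 1 := inv_le_one_of_one_le₀ hL1
    nlinarith
  rw [phiMu_axis_step hL k a hμ hq, abs_mul, abs_mul, abs_neg, abs_of_nonneg (by linarith : (0 : ℝ) ≤ (1 - (L : ℝ)⁻¹ ^ 2) / 6),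
    abs_of_nonneg (by positivity : (0 : ℝ) ≤ ((L : ℝ)⁻¹ ^ 2) ^ k)]

end Phi

/-! ## §4 (v2) The printed two-sided bound (1.85) on the axis, with sharp constants, uniformly in the depth -/

section Uniform

open Literature.MathematicalPhysics.QuantumFieldTheory.Balaban1983to89.B4Strip (Delta1r)

/-- [bookkeeping] On the axis `Δ₀(p′) = Σ_ν S₁(p′_ν) = S₁(q) = 4 sin²(q∕2)`. [folklore] -/
theorem Delta1r_axis (ι : Fin d) (q : ℝ) : Delta1r 0 (axisMom ι q) = 4 * Real.sin (q / 2) ^ 2 := by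
  unfold Delta1r
  rw [add_zero, Finset.sum_eq_single ι (fun ν _ hν => by rw [axisMom, if_neg hν, S1r_zero]) (fun h => absurd (Finset.mem_univ ι) h),
    axisMom, if_pos rfl, S1r_eq]

/-- **THE PRINTED (1.85) QUANTITY ON THE AXIS, EXACTLY**: `Δ₀(q·e_ι)·φ_μ(q·e_ι) = 4 sin²(q∕2) + a·((2 + cos q)∕3 + 2 sin²(q∕2)∕(3n²))` (`1 ≤ n`, `μ ≠ ι`, `sin(q∕2) ≠ 0`).
[cite: Balaban1984PropagatorsI, (1.85) p.31] -/
theorem Delta0_mul_phiMu_axis_eq {n : ℕ} [NeZero n] (hn : 1 ≤ n) (a : ℝ) {ι μ : Fin d} (hμ : μ ≠ ι) {q : ℝ} (hq : Real.sin (q / 2) ≠ 0) :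
    Delta1r 0 (axisMom ι q) * phiMu n a μ (axisMom ι q) =
      4 * Real.sin (q / 2) ^ 2 + a * ((2 + Real.cos q) / 3 + 2 * Real.sin (q / 2) ^ 2 / (3 * (n : ℝ) ^ 2)) := by
  have hn0 : (n : ℝ) ≠ 0 := by exact_mod_cast (by omega : n ≠ 0)
  rw [Delta1r_axis, phiMu_axis_eq hn a hμ hq]
  field_simp
  ring

/-- **SHARP UNIFORM CONSTANTS ON THE AXIS**: for `0 ≤ a`, `1 ≤ n`, `μ ≠ ι`, `sin(q∕2) ≠ 0`: `a∕3 ≤ Δ₀φ_μ ≤ 4 + 5a∕3` — uniformly in the averaging depth (the tree's general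
bounds `ineq185_lower`∕`ineq185_upper'`: `a(4∕π²)^{d+2} ≤ Δ₀φ_μ ≤ 4d + a + a·d`; here `cos q = 1 − 2sin²(q∕2)` makes both sides explicit). [folklore] -/
theorem Delta0_mul_phiMu_axis_bounds {n : ℕ} [NeZero n] (hn : 1 ≤ n) {a : ℝ} (ha : 0 ≤ a) {ι μ : Fin d} (hμ : μ ≠ ι) {q : ℝ} (hq : Real.sin (q / 2) ≠ 0) :
    a / 3 ≤ Delta1r 0 (axisMom ι q) * phiMu n a μ (axisMom ι q) ∧ Delta1r 0 (axisMom ι q) * phiMu n a μ (axisMom ι q) ≤ 4 + 5 * a / 3 := by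
  rw [Delta0_mul_phiMu_axis_eq hn a hμ hq]
  have hS0 : 0 ≤ Real.sin (q / 2) ^ 2 := sq_nonneg _
  have hS1 : Real.sin (q / 2) ^ 2 ≤ 1 := Real.sin_sq_le_one _
  have hc : Real.cos q = 1 - 2 * Real.sin (q / 2) ^ 2 := by
    rw [show q = 2 * (q / 2) by ring, Real.cos_two_mul, ← Real.sin_sq_add_cos_sq (q / 2)]; ring_nf
  have hn1 : (1 : ℝ) ≤ (n : ℝ) ^ 2 := by
    have : (1 : ℝ) ≤ n := by exact_mod_cast hn
    nlinarith
  have hfrac0 : 0 ≤ 2 * Real.sin (q / 2) ^ 2 / (3 * (n : ℝ) ^ 2) := by positivity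
  have hfrac1 : 2 * Real.sin (q / 2) ^ 2 / (3 * (n : ℝ) ^ 2) ≤ 2 / 3 := by
    rw [div_le_div_iff₀ (by positivity) (by norm_num)]; nlinarith
  rw [hc]
  constructor <;> nlinarith [mul_nonneg ha hS0, mul_nonneg ha hfrac0, mul_le_mul_of_nonneg_left hfrac1 ha, mul_le_mul_of_nonneg_left hS1 ha]

end Uniform

end BalabanPhiAxis

end Summit.QuantumFields.BalabanUV.T4Continuum.Spine.NE4
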